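import Summits.QuantumFields.BalabanUV.Beta.SymCorrectorRest
import Summits.QuantumFields.BalabanUV.Beta.D1BFx.ChartDefectWordsLiteral

/-!
# `BalabanUV.Beta.SymCorrectorLiteralW` — binder row D1, road «BF-x» junction (J1), brick TT8: THE LITERAL's WHOLE W SLOT, TRANSPORTED TO THE ROAD's KERNEL
# (the corollary the road OWNER's `D1BFx/ChartDefectWords` (docstring l.25) reserved for the W-rest supplier; OWNER word W-g23-10, journal l.49615; leaf-03 W-5 l.49682)

THE MATHEMATICS.  `D1BFx/ChartDefectWordsLiteral.chartDefect_literal_eq_words` writes the chart defect of the (III′) literal at one blocking as three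
one-loop words at the road's kernel `G₀ := coDressKBmAt (toSite (ctrOff 4 n)) n (KInvStep n 0)`, keeping the literal's second-order slot WHOLE:
`Wᵈ μ y ν y′ := Ψ̂ᵀ ∘ W⁰ μ y ν y′ ∘ Ψ̂ − W μ y ν y′`, `W⁰ := (JsB12CombSh0 … 0).W`, `Ψ̂ := psiKS (ctrOff 4 n) n`.  Here `W⁰` is opened:
* §1 (generic `d`, any root `r ∈ box (d+1) n`, any spread `K`): `loc_dM_of_spr` (the first background derivative `dM K n S M ν y′` of a spread kernel with
  localised tables is a localised kernel — `SecondOrderResponse.vertexFamily_dM` at the common rate); **`W2OfK_conj_psiKS'`** = TT6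
  `SymCorrectorRest.W2OfK_conj_psiKS` with its `Loc (dM …)` socket DISCHARGED and the inner derivative transported by TT6 `dM_conj_psiKS`:
  `W2OfK (Ψ̂∘K∘Ψ̂ᵀ) n S M S₂ M₂ μ y ν y′ = vertex2OfK K n (slot∘slot S₂) μ y ν y′ + mixOfK K n (slot M₂) μ y ν y′ + mixOfK K n (slot M₂) ν y′ μ y
   + dM (−(K ∘ (Ψ̂ᵀ ∘ dM K n (slot S) M ν y′ ∘ Ψ̂) ∘ K)) n (slot S) M μ y`, `slot := slotPsiS r n`; **`W2SymOfK_conj_psiKS`**: the same for an1's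
  swap-symmetrised carrier `W2SymOfK = ½•(W2OfK μ y ν y′ + W2OfK ν y′ μ y)` (`SecondOrderResponse` §6).
* §2 (d = 3, `n` odd): **`JsB12CombSh0_W_zero_eq`** — the literal's W slot at level 0 IS `W2SymOfK (GcombSh n 0) n S♭ (tabs.M 0) S₂⁰ M₂⁰` with the level-0
  tables DISPLAYED (`G`-free): `S♭ κ u := n⁴ • wilsonA 3 κ u + (−n⁸∕2) • tabs.V κ u`, `S₂⁰ κ u κ′ u′ := n⁸ • wilsonW₂ 3 ((8N²)⁻¹ • wsym22 N) κ u κ′ u′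
  + cB • tabs.vh₂S κ u κ′ u′`, `M₂⁰ := M2Of 3 n tabs.mixFF 0` (`rfl` through `JsB12CombSh0_eq`, `JsComb0Of_W`, `WcombOf_eq`, `WrecOf_eq`);
  **`JsB12CombSh0_W_zero_eq_transported`** — HYPOTHESIS-FREE: by leaf-03's CHART TRANSPORT `GcombSh n 0 = Ψ̂∘G₀∘Ψ̂ᵀ` and §1,
  `W⁰ μ y ν y′ = ½ • (E μ y ν y′ + E ν y′ μ y)` with `E` the four transported words at `G₀` (sockets discharged from the record's own letters
  `spr_G₀bm`, `locStencil_SpureCombOf`, `tabs.hM`, `RecursiveWSlot.T2RecOf_loc`, `locStencilFM_M2Of tabs.hmix`).  The literal's leg-dressed W word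
  `Ψ̂ᵀ ∘ W⁰ μ 0 ν z ∘ Ψ̂` of `chartDefect_literal_eq_words` is so rewritten by ONE `rw`; the reference `W` and the split of the tadpole word by
  `TameKernelCalculus.tadpole_add` stay the consumer's.

HONEST DEPENDENCY (cell records, verbatim): «continuum YM on T⁴ ⇐ BetaPertH ∧ nine spine estimates (0/9 proved); BetaPertH ⇐ (D1) ∧ (D4) ∧
CAP+tail; G-an2-4 gates asym, D1 and NE2/3/4.»  HONEST FRAMING (cell contract, verbatim): «discharging `BetaPertH` makes Bałaban's UV stability
UNCONDITIONAL — a real constructive-QFT result; it is NOT the continuum limit and NOT the Clay problem.»  THIS MODULE DISCHARGES NOTHING of (K), of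
(J1)'s row, of D1 or of the wall: [folklore] exact identities between OUR kernels BY NAME; prices NO row, asserts no currency and NO Ward law, proves
NO clause of B12 Thm 2 ∕ Erice and NO estimate of Bałaban's.  No definition, no `def … : Prop`, nothing cited, 0 sorry.  0∕4 row-D1 binders; (K) NOT
closed; (J1) = ONE OPEN ROW; NOT D1, NEVER «G-an2-4 closed», NOT `BetaPertH`, NOT continuum, NOT Clay.

D1 formalisation swarm LEAF 03 (`b2b-balaban-beta-d1-formalise-leaf-03`, gen 29), 2026-08-23; over TT6 `SymCorrectorRest` (p351197) and the OWNER's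
`D1BFx/ChartDefectWordsLiteral` (p351498) BY NAME; no existing file touched.
-/

open scoped BigOperators
open Literature.MathematicalPhysics.QuantumFieldTheory
open Literature.MathematicalPhysics.QuantumFieldTheory.Balaban1983to89
open Literature.MathematicalPhysics.QuantumFieldTheory.Balaban1983to89.Beta
open B12Sec2to5 (l1 l1_nonneg)
open ExpKernelCalculus (MKer Decays BiLoc comp VertexFamily)
open OneStepResolventKernel (Fib LocStencil)
open OneStepKernelFamily (KInvStep vertexOfK)
open SecondOrderResponse (vertexOfM dM dM_apply K2OfK mixOfK W2OfK W2OfK_apply W2SymOfK vertex2OfK LocStencilFM vertexFamily_dM)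
open BalabanCompositeJets (LocStencil₂)
open BalabanStepJets (locStencil_mono)
open BalabanStepW2 (M2Of locStencilFM_M2Of vertexFamily_mono')
open StepJetData (wilsonA)
open WilsonBiStencil (wilsonW₂)
open WilsonVertex2Sym (wsym22)
open AffineAveraging (Site box toSite)
open AveragingContoursRooted (ctrOff ctrOff_mem_box)
open Summit.QuantumFields.BalabanUV.Beta.TameKernelCalculus (Spr Loc trK Spr.trK decays_of_le)
open Summit.QuantumFields.BalabanUV.Beta.ChartConjugationRelative (spr_comp)
open Summit.QuantumFields.BalabanUV.Beta.AxialDressingRooted (coDressKBmAt one_le_of_neZero)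
open Summit.QuantumFields.BalabanUV.Beta.SymmetrisedStepJets (SymTables)
open Summit.QuantumFields.BalabanUV.Beta.CombChartStepJets (GcombSh JsB12CombSh0 SpureCombOf decays_GcombSh locStencil_SpureCombOf)
open Summit.QuantumFields.BalabanUV.Beta.SpineRooted (T2RecOf T2RecOf_loc)
open Summit.QuantumFields.BalabanUV.Beta.SymCorrectorKernel (psiKS spr_psiKS)
open Summit.QuantumFields.BalabanUV.Beta.SymCorrectorFace (slotPsiS)
open Summit.QuantumFields.BalabanUV.Beta.SymCorrectorTransport (GcombSh_zero_eq_conj_psiKS_KInvStep)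
open Summit.QuantumFields.BalabanUV.Beta.SymCorrectorRest (dM_conj_psiKS W2OfK_conj_psiKS)
open Summit.QuantumFields.BalabanUV.Beta.D1BFx.ChartDefectWordsLiteral (spr_G₀bm)

noncomputable section

namespace Summit.QuantumFields.BalabanUV.Beta.SymCorrectorLiteralW

variable {d : ℕ}

/-! ## §1 Generic: the `Loc (dM …)` socket, and the second-order carriers of a conjugated kernel fully transported -/

section Generic

variable {n : ℕ}

/-- [folklore] **THE FIRST BACKGROUND DERIVATIVE OF A SPREAD KERNEL WITH LOCALISED TABLES IS A LOCALISED KERNEL** (`vertexFamily_dM` at the common rate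
`min δK (min δs δM)`; the `hD` socket of TT6 `K2OfK_conj_psiKS` ∕ `W2OfK_conj_psiKS`; `n ≠ 0`). -/
theorem loc_dM_of_spr [NeZero n] {K : MKer (d + 1) (Fib d)} (hK : Spr K) {S : Fin (d + 1) → Site (d + 1) → MKer (d + 1) (Fib d)} {Cs δs : ℝ}
    (hS : LocStencil S Cs δs) (hδs : 0 < δs) {M : Fin (d + 1) → Site (d + 1) → MKer (d + 1) (Fib d)} {CM δM : ℝ} (hM : VertexFamily M n CM δM)
    (hδM : 0 < δM) (ν : Fin (d + 1)) (y' : Site (d + 1)) : Loc (dM K n S M ν y') := by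
  obtain ⟨C, δK, hδK, hKd⟩ := hK
  have hC : 0 ≤ C := hKd.nonneg (Sum.inl 0)
  have hm : 0 < min δK (min δs δM) := lt_min hδK (lt_min hδs hδM)
  have hS' : LocStencil S Cs (min δK (min δs δM)) :=
    locStencil_mono hS ((hS 0 0).nonneg (Sum.inl 0)) ((min_le_right _ _).trans (min_le_left _ _))
  have hM' : VertexFamily M n CM (min δK (min δs δM)) :=
    vertexFamily_mono' hM ((hM 0 0).nonneg (Sum.inl 0)) ((min_le_right _ _).trans (min_le_right _ _))
  have hV := vertexFamily_dM (N := n) hKd hC hS' hM' hm (min_le_left _ _)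
  exact ⟨_, _, _, _, half_pos hm, hV ν y'⟩

variable (hn : 0 < n) {r : Fin (d + 1) → ℕ} (hr : r ∈ box (d + 1) n)
include hn hr

/-- [folklore] TT6 `dM_conj_psiKS`, folded: `dM (Ψ̂∘K∘Ψ̂ᵀ) n S M ν y′ = dM K n (slotPsiS r n S) M ν y′`. -/
theorem dM_conj_psiKS' {K : MKer (d + 1) (Fib d)} (hK : Spr K) {S : Fin (d + 1) → Site (d + 1) → MKer (d + 1) (Fib d)} {Cs δs : ℝ}
    (hS : LocStencil S Cs δs) (hδs : 0 < δs) (M : Fin (d + 1) → Site (d + 1) → MKer (d + 1) (Fib d)) (ν : Fin (d + 1)) (y' : Site (d + 1)) :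
    dM (comp (comp (psiKS r n) K) (trK (psiKS r n))) n S M ν y' = dM K n (slotPsiS r n S) M ν y' := by
  rw [dM_conj_psiKS hn hr hK hS hδs M ν y']
  rfl

/-- [folklore] **THE SECOND-ORDER CARRIER OF A CONJUGATED KERNEL, FULLY TRANSPORTED** — TT6 `W2OfK_conj_psiKS` with the `Loc (dM …)` socket discharged
(`loc_dM_of_spr` at the conjugated kernel, which is spread) and the inner derivative written at `K` (`dM_conj_psiKS'`):
`W2OfK (Ψ̂∘K∘Ψ̂ᵀ) n S M S₂ M₂ μ y ν y′ = vertex2OfK K n (slot∘slot S₂) μ y ν y′ + mixOfK K n (slot M₂) μ y ν y′ + mixOfK K n (slot M₂) ν y′ μ y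
+ dM (−(K ∘ (Ψ̂ᵀ ∘ dM K n (slot S) M ν y′ ∘ Ψ̂) ∘ K)) n (slot S) M μ y`. -/
theorem W2OfK_conj_psiKS' {K : MKer (d + 1) (Fib d)} (hK : Spr K)
    {S : Fin (d + 1) → Site (d + 1) → MKer (d + 1) (Fib d)} {Cs δs : ℝ} (hS : LocStencil S Cs δs) (hδs : 0 < δs)
    {M : Fin (d + 1) → Site (d + 1) → MKer (d + 1) (Fib d)} {CM δM : ℝ} (hM : VertexFamily M n CM δM) (hδM : 0 < δM)
    {S₂ : Fin (d + 1) → Site (d + 1) → Fin (d + 1) → Site (d + 1) → MKer (d + 1) (Fib d)} {C₂ δ₂ : ℝ} (hS₂ : LocStencil₂ S₂ C₂ δ₂) (hδ₂ : 0 < δ₂)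
    {M₂ : Fin (d + 1) → Site (d + 1) → Fin (d + 1) → Site (d + 1) → MKer (d + 1) (Fib d)} {CF δF : ℝ} (hM₂ : LocStencilFM n M₂ CF δF) (hδF : 0 < δF)
    (μ : Fin (d + 1)) (y : Site (d + 1)) (ν : Fin (d + 1)) (y' : Site (d + 1)) :
    W2OfK (comp (comp (psiKS r n) K) (trK (psiKS r n))) n S M S₂ M₂ μ y ν y'
      = vertex2OfK K n (fun α x => slotPsiS r n (slotPsiS r n S₂ α x)) μ y ν y'
        + mixOfK K n (slotPsiS r n M₂) μ y ν y' + mixOfK K n (slotPsiS r n M₂) ν y' μ y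
        + dM (-(comp (comp K (comp (comp (trK (psiKS r n)) (dM K n (slotPsiS r n S) M ν y')) (psiKS r n))) K)) n (slotPsiS r n S) M μ y := by
  haveI : NeZero n := ⟨hn.ne'⟩
  have hK' : Spr (comp (comp (psiKS r n) K) (trK (psiKS r n))) := spr_comp (spr_comp (spr_psiKS hn hr) hK) (spr_psiKS hn hr).trK
  rw [W2OfK_conj_psiKS hn hr hK hS hδs M hS₂ hδ₂ hM₂ hδF μ y ν y' (loc_dM_of_spr hK' hS hδs hM hδM ν y'), dM_conj_psiKS' hn hr hK hS hδs M ν y']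

/-- [folklore] **THE SWAP-SYMMETRISED CARRIER OF A CONJUGATED KERNEL, FULLY TRANSPORTED**: `W2SymOfK (Ψ̂∘K∘Ψ̂ᵀ) n S M S₂ M₂ μ y ν y′ = ½ • (E μ y ν y′ + E ν y′ μ y)`
with `E` the right-hand side of `W2OfK_conj_psiKS'`. -/
theorem W2SymOfK_conj_psiKS {K : MKer (d + 1) (Fib d)} (hK : Spr K)
    {S : Fin (d + 1) → Site (d + 1) → MKer (d + 1) (Fib d)} {Cs δs : ℝ} (hS : LocStencil S Cs δs) (hδs : 0 < δs)
    {M : Fin (d + 1) → Site (d + 1) → MKer (d + 1) (Fib d)} {CM δM : ℝ} (hM : VertexFamily M n CM δM) (hδM : 0 < δM)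
    {S₂ : Fin (d + 1) → Site (d + 1) → Fin (d + 1) → Site (d + 1) → MKer (d + 1) (Fib d)} {C₂ δ₂ : ℝ} (hS₂ : LocStencil₂ S₂ C₂ δ₂) (hδ₂ : 0 < δ₂)
    {M₂ : Fin (d + 1) → Site (d + 1) → Fin (d + 1) → Site (d + 1) → MKer (d + 1) (Fib d)} {CF δF : ℝ} (hM₂ : LocStencilFM n M₂ CF δF) (hδF : 0 < δF)
    (μ : Fin (d + 1)) (y : Site (d + 1)) (ν : Fin (d + 1)) (y' : Site (d + 1)) :
    W2SymOfK (comp (comp (psiKS r n) K) (trK (psiKS r n))) n S M S₂ M₂ μ y ν y'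
      = (1 / 2 : ℝ) •
        ((vertex2OfK K n (fun α x => slotPsiS r n (slotPsiS r n S₂ α x)) μ y ν y'
            + mixOfK K n (slotPsiS r n M₂) μ y ν y' + mixOfK K n (slotPsiS r n M₂) ν y' μ y
            + dM (-(comp (comp K (comp (comp (trK (psiKS r n)) (dM K n (slotPsiS r n S) M ν y')) (psiKS r n))) K)) n (slotPsiS r n S) M μ y)
          + (vertex2OfK K n (fun α x => slotPsiS r n (slotPsiS r n S₂ α x)) ν y' μ y
            + mixOfK K n (slotPsiS r n M₂) ν y' μ y + mixOfK K n (slotPsiS r n M₂) μ y ν y'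
            + dM (-(comp (comp K (comp (comp (trK (psiKS r n)) (dM K n (slotPsiS r n S) M μ y)) (psiKS r n))) K)) n (slotPsiS r n S) M ν y')) := by
  unfold W2SymOfK
  rw [W2OfK_conj_psiKS' hn hr hK hS hδs hM hδM hS₂ hδ₂ hM₂ hδF μ y ν y', W2OfK_conj_psiKS' hn hr hK hS hδs hM hδM hS₂ hδ₂ hM₂ hδF ν y' μ y]

end Generic

/-! ## §2 d + 1 = 4: the literal's whole W slot at level 0, by name and transported to `G₀` -/

section Literal

variable (n : ℕ) [NeZero n] (hodd : Odd n) (N : ℕ) (tabs : SymTables 3 n) (cΛ cB : ℝ)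

/-- [folklore] **THE LITERAL's W SLOT AT LEVEL 0, BY NAME** (`rfl`): `(JsB12CombSh0 … 0).W μ y ν y′ = W2SymOfK (GcombSh n 0) n S♭ (tabs.M 0) S₂⁰ (M2Of 3 n tabs.mixFF 0) μ y ν y′`
with the `G`-free level-0 tables `S♭ κ u := n⁴ • wilsonA 3 κ u + (−n⁸∕2) • tabs.V κ u`, `S₂⁰ κ u κ′ u′ := n⁸ • wilsonW₂ 3 ((8N²)⁻¹ • wsym22 N) κ u κ′ u′ + cB • tabs.vh₂S κ u κ′ u′`. -/
theorem JsB12CombSh0_W_zero_eq (μ : Fin 4) (y : Fin 4 → ℤ) (ν : Fin 4) (y' : Fin 4 → ℤ) :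
    (JsB12CombSh0 hodd N tabs cΛ cB 0).W μ y ν y'
      = W2SymOfK (GcombSh (d := 3) n 0) n (fun κ u => ((n : ℝ) ^ 4) • wilsonA 3 κ u + (-((n : ℝ) ^ 8 / 2)) • tabs.V κ u) (tabs.M 0)
          (fun κ u κ' u' => ((n : ℝ) ^ 8) • wilsonW₂ 3 ((8 * (N : ℝ) ^ 2)⁻¹ • wsym22 N) κ u κ' u' + cB • tabs.vh₂S κ u κ' u')
          (M2Of 3 n tabs.mixFF 0) μ y ν y' :=
  rfl

/-- [folklore] **THE LITERAL's W SLOT AT LEVEL 0, TRANSPORTED TO THE ROAD's KERNEL** (hypothesis-free): with `G₀ := coDressKBmAt (toSite (ctrOff 4 n)) n (KInvStep n 0)`,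
`Ψ̂ := psiKS (ctrOff 4 n) n`, `slot := slotPsiS (ctrOff 4 n) n` and the level-0 tables of `JsB12CombSh0_W_zero_eq`,
`W⁰ μ y ν y′ = ½ • (E μ y ν y′ + E ν y′ μ y)`, `E μ y ν y′ := vertex2OfK G₀ n (slot∘slot S₂⁰) μ y ν y′ + mixOfK G₀ n (slot M₂⁰) μ y ν y′ + mixOfK G₀ n (slot M₂⁰) ν y′ μ y
+ dM (−(G₀ ∘ (Ψ̂ᵀ ∘ dM G₀ n (slot S♭) (tabs.M 0) ν y′ ∘ Ψ̂) ∘ G₀)) n (slot S♭) (tabs.M 0) μ y` (CHART TRANSPORT `GcombSh n 0 = Ψ̂∘G₀∘Ψ̂ᵀ` + `W2SymOfK_conj_psiKS`;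
sockets from `spr_G₀bm`, `locStencil_SpureCombOf`, `tabs.hM`, `T2RecOf_loc`, `locStencilFM_M2Of tabs.hmix`). -/
theorem JsB12CombSh0_W_zero_eq_transported (μ : Fin 4) (y : Fin 4 → ℤ) (ν : Fin 4) (y' : Fin 4 → ℤ) :
    (JsB12CombSh0 hodd N tabs cΛ cB 0).W μ y ν y'
      = (1 / 2 : ℝ) •
        ((vertex2OfK (coDressKBmAt (toSite (ctrOff 4 n)) n (KInvStep (d := 3) n 0)) n
              (fun α x => slotPsiS (ctrOff 4 n) n (slotPsiS (ctrOff 4 n) n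
                (fun κ u κ' u' => ((n : ℝ) ^ 8) • wilsonW₂ 3 ((8 * (N : ℝ) ^ 2)⁻¹ • wsym22 N) κ u κ' u' + cB • tabs.vh₂S κ u κ' u') α x)) μ y ν y'
            + mixOfK (coDressKBmAt (toSite (ctrOff 4 n)) n (KInvStep (d := 3) n 0)) n (slotPsiS (ctrOff 4 n) n (M2Of 3 n tabs.mixFF 0)) μ y ν y'
            + mixOfK (coDressKBmAt (toSite (ctrOff 4 n)) n (KInvStep (d := 3) n 0)) n (slotPsiS (ctrOff 4 n) n (M2Of 3 n tabs.mixFF 0)) ν y' μ y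
            + dM (-(comp (comp (coDressKBmAt (toSite (ctrOff 4 n)) n (KInvStep (d := 3) n 0))
                  (comp (comp (trK (psiKS (ctrOff 4 n) n))
                    (dM (coDressKBmAt (toSite (ctrOff 4 n)) n (KInvStep (d := 3) n 0)) n
                      (slotPsiS (ctrOff 4 n) n (fun κ u => ((n : ℝ) ^ 4) • wilsonA 3 κ u + (-((n : ℝ) ^ 8 / 2)) • tabs.V κ u)) (tabs.M 0) ν y'))
                    (psiKS (ctrOff 4 n) n)))
                  (coDressKBmAt (toSite (ctrOff 4 n)) n (KInvStep (d := 3) n 0))))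
                n (slotPsiS (ctrOff 4 n) n (fun κ u => ((n : ℝ) ^ 4) • wilsonA 3 κ u + (-((n : ℝ) ^ 8 / 2)) • tabs.V κ u)) (tabs.M 0) μ y)
          + (vertex2OfK (coDressKBmAt (toSite (ctrOff 4 n)) n (KInvStep (d := 3) n 0)) n
              (fun α x => slotPsiS (ctrOff 4 n) n (slotPsiS (ctrOff 4 n) n
                (fun κ u κ' u' => ((n : ℝ) ^ 8) • wilsonW₂ 3 ((8 * (N : ℝ) ^ 2)⁻¹ • wsym22 N) κ u κ' u' + cB • tabs.vh₂S κ u κ' u') α x)) ν y' μ y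
            + mixOfK (coDressKBmAt (toSite (ctrOff 4 n)) n (KInvStep (d := 3) n 0)) n (slotPsiS (ctrOff 4 n) n (M2Of 3 n tabs.mixFF 0)) ν y' μ y
            + mixOfK (coDressKBmAt (toSite (ctrOff 4 n)) n (KInvStep (d := 3) n 0)) n (slotPsiS (ctrOff 4 n) n (M2Of 3 n tabs.mixFF 0)) μ y ν y'
            + dM (-(comp (comp (coDressKBmAt (toSite (ctrOff 4 n)) n (KInvStep (d := 3) n 0))
                  (comp (comp (trK (psiKS (ctrOff 4 n) n))
                    (dM (coDressKBmAt (toSite (ctrOff 4 n)) n (KInvStep (d := 3) n 0)) n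
                      (slotPsiS (ctrOff 4 n) n (fun κ u => ((n : ℝ) ^ 4) • wilsonA 3 κ u + (-((n : ℝ) ^ 8 / 2)) • tabs.V κ u)) (tabs.M 0) μ y))
                    (psiKS (ctrOff 4 n) n)))
                  (coDressKBmAt (toSite (ctrOff 4 n)) n (KInvStep (d := 3) n 0))))
                n (slotPsiS (ctrOff 4 n) n (fun κ u => ((n : ℝ) ^ 4) • wilsonA 3 κ u + (-((n : ℝ) ^ 8 / 2)) • tabs.V κ u)) (tabs.M 0) ν y')) := by
  have hn : 0 < n := Nat.pos_of_ne_zero (NeZero.ne n)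
  obtain ⟨Cs, δs, hδs, hS⟩ := locStencil_SpureCombOf (d := 3) tabs ((n : ℝ) ^ 4) (-((n : ℝ) ^ 8 / 2)) cΛ 0
  obtain ⟨CM, δM, hδM, hM⟩ := tabs.hM 0
  obtain ⟨C₂, δ₂, hδ₂, hS₂⟩ := T2RecOf_loc ((n : ℝ) ^ 8) cB ((8 * (N : ℝ) ^ 2)⁻¹ • wsym22 N) tabs.vh₂S tabs.mixFF (one_le_of_neZero n)
    (decays_GcombSh (d := 3) n) (locStencil_SpureCombOf (d := 3) tabs ((n : ℝ) ^ 4) (-((n : ℝ) ^ 8 / 2)) cΛ) tabs.hM tabs.hB tabs.hmix 0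
  obtain ⟨CF, δF, hδF, hmix⟩ := tabs.hmix
  rw [JsB12CombSh0_W_zero_eq, GcombSh_zero_eq_conj_psiKS_KInvStep (d := 3) n]
  exact W2SymOfK_conj_psiKS hn (ctrOff_mem_box hn) (spr_G₀bm n) hS hδs hM hδM hS₂ hδ₂ (locStencilFM_M2Of hmix 0) hδF μ y ν y'

end Literal

end Summit.QuantumFields.BalabanUV.Beta.SymCorrectorLiteralW

end
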